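import Mathlib
import Summits.Ventures.HodgeRepro.Tier4.Line4.AwayDomain
import Summits.Ventures.HodgeRepro.Tier4.Line4.CentreAwayFiniteRow

/-!
# Tier4/Line4/AwayDomainRow — the product domain of record at the SEESAW PLANE, with `hdisc` by name (L1-p2's
C-L4-NONSPLIT-FINITE): ZDOMAIN-EX in the product form `T_S × DZ^{(S)}` on `(mixedRow q a b).withTransportedTorus g g' …`

Blind re-derivation cell `pub-hodge-repro`, Tier 4 «prove the step» (README §9–§10), seat t4-L2-p2 (gen 5; plan-4 g6's
S15767/S15779: «bind (i) `hDA` on L1-p2's discreteness form at the transported plane»).  Tree path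
`lean/Summits/Ventures/HodgeRepro/Tier4/Line4/AwayDomainRow.lean`.  Imports this seat's `Line4/AwayDomain`
(`exists_isFundamentalDomain_prod_univ_of_compactSpace_at`) and L1-p2's `Line4/CentreAwayFiniteRow`
(`discreteTopology_centreAway_withTransportedTorus_of_nonsplit`).  Mathlib-level; no literature; no `def`.

**`exists_isFundamentalDomain_prod_univ_withTransportedTorus`**: on the plane of record, for a prime `p` with the (E1)
local clause `hns` (every place above `p` non-split in `k(√(t² − 4n))`), under the normalisation `ht : q.t = 0`, `hn`,
the CM clauses `hreal`/`hcm`, ZDOMAIN-EX's cocompactness `hZc` and the compactness `hTS` of the `p`-adic torus (L1-p2's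
forthcoming `compactSpace_torusFinAt_of_nonsplit`): a measurable fundamental domain `DA` for `centreAway` in `T_f^{(p)}`,
relatively compact on `Z_f^{(p)}`-saturations of compacts, with `DZ_f := torusFinSplit⁻¹(univ ×ˢ DA)` a measurable
fundamental domain for `Z(k)` in `T_f` satisfying ZDOMAIN-EX (iv) — the `DZf hDZf hfd hDZc` binders of the (7b) glue and
of x2's MainTermSplit at `DZS := univ`.

Nothing here says anything about the status of the Hodge conjecture for CM abelian varieties, which is NOT proved
(HC_CM is NOT proved by anyone in this repository).
-/

set_option autoImplicit false

noncomputable section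

namespace Summit.Ventures.HodgeRepro.Tier4.Line4

open Summit.Ventures.HodgeRepro.Tier4 Summit.Ventures.HodgeRepro.Tier4.Common
  Summit.Ventures.HodgeRepro.Tier4.Line1 NumberField IsDedekindDomain MeasureTheory
open scoped NumberField NNReal ENNReal Pointwise

section Row

variable {k : Type} [Field k] [NumberField k] (q : QuadData k) (a b : k) (g g' : Matrix (Fin 4) (Fin 4) k)
  (hgg' : g * g' = 1) (hg'g : g' * g = 1) (hgΩ : g * (PlaneData.mixedRow q a b).Ω = (PlaneData.mixedRow q a b).Ω * g)

/-- **The product domain of record at the seesaw plane, `hdisc` by name.** -/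
theorem exists_isFundamentalDomain_prod_univ_withTransportedTorus (ha : a ≠ 0) (hb : b ≠ 0) (ht : q.t = 0)
    (hn : ¬ IsSquare (-q.n)) (hreal : ∀ w : InfinitePlace k, w.IsReal) (hcm : ∀ w, IsCMAt q w) {p : ℕ} (hp : p.Prime)
    (hns : ∀ v ∈ placesAbove (k := k) p, ¬ IsSquare (algebraMap k (v.adicCompletion k) (q.t ^ 2 - 4 * q.n)))
    [MeasurableSpace (torusT ((PlaneData.mixedRow q a b).withTransportedTorus g g' hgg' hg'g hgΩ))]
    [BorelSpace (torusT ((PlaneData.mixedRow q a b).withTransportedTorus g g' hgg' hg'g hgΩ))]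
    (νf : Measure (torusFin ((PlaneData.mixedRow q a b).withTransportedTorus g g' hgg' hg'g hgΩ))) [νf.IsHaarMeasure]
    (νS : Measure (torusFinAt ((PlaneData.mixedRow q a b).withTransportedTorus g g' hgg' hg'g hgΩ) (placesAbove (k := k) p)))
    [νS.IsHaarMeasure]
    (νA : Measure (torusFinAway ((PlaneData.mixedRow q a b).withTransportedTorus g g' hgg' hg'g hgΩ) (placesAbove (k := k) p)))
    [νA.IsHaarMeasure] (c : ℝ≥0)
    (hc : νf = c • Measure.map (torusFinSplit ((PlaneData.mixedRow q a b).withTransportedTorus g g' hgg' hg'g hgΩ)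
      (placesAbove (k := k) p)).symm (νS.prod νA))
    (hZc : ∃ E : Set (torusFin ((PlaneData.mixedRow q a b).withTransportedTorus g g' hgg' hg'g hgΩ)), IsCompact E ∧
      E ⊆ (ZfIn ((PlaneData.mixedRow q a b).withTransportedTorus g g' hgg' hg'g hgΩ) : Set _) ∧
      (ZfIn ((PlaneData.mixedRow q a b).withTransportedTorus g g' hgg' hg'g hgΩ) : Set _) ⊆
        (centreFin ((PlaneData.mixedRow q a b).withTransportedTorus g g' hgg' hg'g hgΩ) : Set _) * E)
    (hTS : CompactSpace (torusFinAt ((PlaneData.mixedRow q a b).withTransportedTorus g g' hgg' hg'g hgΩ)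
      (placesAbove (k := k) p))) :
    ∃ DA : Set (torusFinAway ((PlaneData.mixedRow q a b).withTransportedTorus g g' hgg' hg'g hgΩ) (placesAbove (k := k) p)),
      MeasurableSet DA ∧
      IsFundamentalDomain (centreAway ((PlaneData.mixedRow q a b).withTransportedTorus g g' hgg' hg'g hgΩ)
        (placesAbove (k := k) p)) DA νA ∧
      MeasurableSet ((torusFinSplit ((PlaneData.mixedRow q a b).withTransportedTorus g g' hgg' hg'g hgΩ)
        (placesAbove (k := k) p)) ⁻¹' (Set.univ ×ˢ DA)) ∧
      IsFundamentalDomain (centreFin ((PlaneData.mixedRow q a b).withTransportedTorus g g' hgg' hg'g hgΩ))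
        ((torusFinSplit ((PlaneData.mixedRow q a b).withTransportedTorus g g' hgg' hg'g hgΩ) (placesAbove (k := k) p)) ⁻¹'
          (Set.univ ×ˢ DA)) νf ∧
      ∀ C : Set (torusFin ((PlaneData.mixedRow q a b).withTransportedTorus g g' hgg' hg'g hgΩ)), IsCompact C →
        IsCompact (closure (((torusFinSplit ((PlaneData.mixedRow q a b).withTransportedTorus g g' hgg' hg'g hgΩ)
          (placesAbove (k := k) p)) ⁻¹' (Set.univ ×ˢ DA)) ∩
          (C * (ZfIn ((PlaneData.mixedRow q a b).withTransportedTorus g g' hgg' hg'g hgΩ) : Set _)))) :=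
  exists_isFundamentalDomain_prod_univ_of_compactSpace_at _ νf hp νS νA c hc
    (discreteTopology_centreAway_withTransportedTorus_of_nonsplit q a b g g' hgg' hg'g hgΩ ha hb ht hn hreal hcm p
      hp.ne_zero hns) hZc hTS

end Row

end Summit.Ventures.HodgeRepro.Tier4.Line4

end
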